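import Summits.AnomalousDissipation.AnomalousDissipation.Theorems.SolenoidalFractalHomogenisationLagrangianStepSidebandLadderAlgebra
import Summits.AnomalousDissipation.AnomalousDissipation.Theorems.SolenoidalFractalHomogenisationLagrangianStepSidebandXDefectSum
import Summits.AnomalousDissipation.AnomalousDissipation.Theorems.SolenoidalFractalHomogenisationLagrangianStepLadderGeometry
import Literature.Analysis.FluidPDE.PassiveVectorTensorDissipationDensity
import HarnessLib

/-!
# K1L_D `stub_D1_V0thg` (stmt-AnomalousDissipation-27980), R3′ lane «SidebandTailCrushing» (tenure D28-16 (3) / D28-20) — file F4b: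
# LADDER BOUNDS — the local constants `lo₁`, `A`, `CJ` of the hypocoercivity lemma for the sideband ladder instance

Helper file of route `SolenoidalFractalHomogenisation` (prover seat `ad-k1l-cellLawV-w1` g10; plan memo
`Cruxes/LagrangianRenormalisationStepDesign/Lines/onelevel-vtheta-R3-plan.md` §3 (P); `--supports stmt-AnomalousDissipation-27980 --as helper`).
For `NearIso 𝔸 lo' hi'` and a transversal state `u` of `Sideband.Space R` (`u ∈ ladderSub R L`):
* `real_inner_dampL_ge` / `_le`: `4π²·lo'·Σ_z |z|²‖u_z‖² ≤ ⟪dampL u, u⟫_ℝ ≤ 4π²·|hi'|·Σ_z |z|²‖u_z‖²` (Legendre–Hadamard window on transversal pairs);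
* `siteIndex_sq_le` (`κ_m(z)² ≤ 7|z|²` on the punctured lattice) ⇒ **h1** `lo₁‖K u‖² ≤ ⟪dampL u,u⟫` with `lo₁ = 4π²lo'/7` (`inner_dampL_ge_indexL`);
* on an `mᵢ`-ladder through `z₀`: the bond operator `C = K hopL − hopL K` satisfies **h3** `‖Cu‖² ≤ 4a²‖u‖²` and **h2** `⟪dampL(Cu), Cu⟫ ≤ (8a²(1+|mᵢ|²)|hi'|/lo')⟪dampL u,u⟫`,
  `a = 2π|êᵢ·z₀|·‖αᵢ‖` (= `|êᵢ·z₀|/(2|mᵢ|)`, the bond modulus at unit envelope; `êᵢ·z` is constant along the ladder since `êᵢ ⊥ mᵢ`);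
* weighted shift bookkeeping `sum_weight_norm_sq_coordL_sub_le/add_le` (generalising `Sideband.sum_norm_sq_coordL_sub_le`).
No definitions, no sorry.  NOT a proof of `stub_D1_V0thg`, of K1L_D or of AD; rung F-D1.A0 infrastructure.
-/

set_option linter.dupNamespace false -- single-conjunct summit: `Summit.AnomalousDissipation.AnomalousDissipation.…` is the mandated namespace

noncomputable section

namespace Summit.AnomalousDissipation.AnomalousDissipation.Theorems.SolenoidalFractalHomogenisation.LagrangianStep.Sideband

open Set Complex
open scoped InnerProductSpace
open Literature.Analysis Literature.Analysis.FunctionSpaces Literature.Analysis.FunctionSpaces.Torus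
open Literature.Analysis.FluidPDE Literature.Analysis.FluidPDE.Torus Literature.Analysis.FluidPDE.LatticeShear
open Summit.AnomalousDissipation.AnomalousDissipation.Theorems.SolenoidalFractalHomogenisation.LagrangianStep.CellChain
  (linkCoeff kdot_transversalProj' inner_transversalProj_left_of_kdot_eq_zero norm_transversalProj_le)
open Summit.AnomalousDissipation.AnomalousDissipation.Theorems.SolenoidalFractalHomogenisation.LagrangianStep.W7Slot (dot_sq_le_freqNormSq_mul)

variable {k₀ : ℕ}

/-! ## §1 Weighted shift bookkeeping on the box -/

/-- **Weighted shift**: `Σ_z g(z−m)‖coordL_{z−m} y‖² ≤ Σ_u g(u)‖y_u‖²` for a nonnegative weight `g` (each amplitude is read at most once).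
[cite: MajdaKramer1999, §2.2.1.3] -/
theorem sum_weight_norm_sq_coordL_sub_le {R : ℕ} (g : (Fin 3 → ℤ) → ℝ) (hg : ∀ w, 0 ≤ g w) (m : Fin 3 → ℤ) (y : Space R) :
    ∑ z : box R, g (z.1 - m) * ‖coordL R (z.1 - m) y‖ ^ 2 ≤ ∑ u : box R, g u.1 * ‖y u‖ ^ 2 := by
  classical
  have hrw : ∀ z : box R, g (z.1 - m) * ‖coordL R (z.1 - m) y‖ ^ 2
      = ∑ u : box R, if (u : Fin 3 → ℤ) = z.1 - m then g u.1 * ‖y u‖ ^ 2 else 0 := by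
    intro z
    rw [norm_sq_coordL_eq_sum, Finset.mul_sum]
    refine Finset.sum_congr rfl fun u _ => ?_
    split_ifs with h
    · rw [h]
    · rw [mul_zero]
  simp_rw [hrw]
  rw [Finset.sum_comm]
  refine Finset.sum_le_sum fun u _ => ?_
  have hcond : ∀ z : box R, ((u : Fin 3 → ℤ) = z.1 - m) = ((z : Fin 3 → ℤ) = u.1 + m) := by
    intro z; apply propext; constructor <;> intro h
    · rw [h]; abel
    · rw [h]; abel
  simp_rw [hcond]
  have h1 := sum_ite_coe_eq_le_one R (u.1 + m)
  have hnn : 0 ≤ g u.1 * ‖y u‖ ^ 2 := mul_nonneg (hg _) (sq_nonneg _)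
  calc ∑ z : box R, (if (z : Fin 3 → ℤ) = u.1 + m then g u.1 * ‖y u‖ ^ 2 else 0)
      = (∑ z : box R, (if (z : Fin 3 → ℤ) = u.1 + m then (1:ℝ) else 0)) * (g u.1 * ‖y u‖ ^ 2) := by
        rw [Finset.sum_mul]; refine Finset.sum_congr rfl fun z _ => ?_; split_ifs <;> simp
    _ ≤ 1 * (g u.1 * ‖y u‖ ^ 2) := mul_le_mul_of_nonneg_right h1 hnn
    _ = g u.1 * ‖y u‖ ^ 2 := one_mul _

/-- `Σ_z g(z+m)‖coordL_{z+m} y‖² ≤ Σ_u g(u)‖y_u‖²`. [cite: MajdaKramer1999, §2.2.1.3] -/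
theorem sum_weight_norm_sq_coordL_add_le {R : ℕ} (g : (Fin 3 → ℤ) → ℝ) (hg : ∀ w, 0 ≤ g w) (m : Fin 3 → ℤ) (y : Space R) :
    ∑ z : box R, g (z.1 + m) * ‖coordL R (z.1 + m) y‖ ^ 2 ≤ ∑ u : box R, g u.1 * ‖y u‖ ^ 2 := by
  have h := sum_weight_norm_sq_coordL_sub_le g hg (-m) y
  simpa [sub_neg_eq_add] using h

/-! ## §2 The damping form on transversal states -/

/-- The damping form on a transversal state, fibrewise: `Re⟪(dampL u)_z, u_z⟫ = 4π²·Re⟪u_z, T_{𝔸ᵀ}(z) u_z⟫`. [cite: Frisch1995Turbulence, §9.6.3 eq. (9.57) p. 233] -/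
theorem re_inner_dampL_apply {R : ℕ} {L : Set (Fin 3 → ℤ)} (𝔸 : Torus.Visc4 (Fin 3)) (γ₁ : ℝ) {u : Space R} (hu : u ∈ ladderSub R L)
    (z : box R) :
    (⟪dampL 𝔸 γ₁ R u z, u z⟫_ℂ).re = 4 * Real.pi ^ 2 * (⟪u z, Torus.symbT (Torus.majorTranspose 𝔸) z.1 (u z)⟫_ℂ).re := by
  have hP := transversalProj_apply_of_mem_ladderSub hu z
  have hk := kdot_eq_zero_of_mem_ladderSub hu z
  rw [dampL_apply, dampComp_apply, hP, sub_self, smul_zero, add_zero, inner_smul_left, Complex.conj_ofReal, Complex.re_ofReal_mul,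
    inner_transversalProj_left_of_kdot_eq_zero z.1 hk, ← inner_conj_symm, Complex.conj_re]

/-- **Lower Legendre–Hadamard window**: `4π²·lo'·Σ_z |z|²‖u_z‖² ≤ ⟪dampL u, u⟫_ℝ` for transversal `u` and `NearIso 𝔸 lo' hi'`.
[cite: Giaquinta1983MultipleIntegrals, Ch. III §2 eq. (2.2)] -/
theorem real_inner_dampL_ge {R : ℕ} {L : Set (Fin 3 → ℤ)} {𝔸 : Torus.Visc4 (Fin 3)} {lo' hi' : ℝ} (h𝔸 : Torus.NearIso 𝔸 lo' hi')
    (γ₁ : ℝ) {u : Space R} (hu : u ∈ ladderSub R L) :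
    4 * Real.pi ^ 2 * lo' * ∑ z : box R, freqNormSq z.1 * ‖u z‖ ^ 2 ≤ ⟪dampL 𝔸 γ₁ R u, u⟫_ℝ := by
  have hT : Torus.NearIso (Torus.majorTranspose 𝔸) lo' hi' := (Torus.nearIso_majorTranspose_iff 𝔸 lo' hi').2 h𝔸
  rw [real_inner_space_eq_sum, Finset.mul_sum]
  refine Finset.sum_le_sum fun z _ => ?_
  rw [re_inner_dampL_apply 𝔸 γ₁ hu z]
  have hk : ∑ j, (z.1 j : ℂ) * (u z) j = 0 := by rw [← kdot_apply]; exact kdot_eq_zero_of_mem_ladderSub hu z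
  have h := Torus.lo_mul_le_re_inner_symbT hT hk
  nlinarith [h, Real.pi_pos]

/-- **Upper Legendre–Hadamard window**: `⟪dampL u, u⟫_ℝ ≤ 4π²·|hi'|·Σ_z |z|²‖u_z‖²` for transversal `u` and `NearIso 𝔸 lo' hi'`.
[cite: Giaquinta1983MultipleIntegrals, Ch. III §2 eq. (2.2)] -/
theorem real_inner_dampL_le {R : ℕ} {L : Set (Fin 3 → ℤ)} {𝔸 : Torus.Visc4 (Fin 3)} {lo' hi' : ℝ} (h𝔸 : Torus.NearIso 𝔸 lo' hi')
    (γ₁ : ℝ) {u : Space R} (hu : u ∈ ladderSub R L) :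
    ⟪dampL 𝔸 γ₁ R u, u⟫_ℝ ≤ 4 * Real.pi ^ 2 * |hi'| * ∑ z : box R, freqNormSq z.1 * ‖u z‖ ^ 2 := by
  have hT : Torus.NearIso (Torus.majorTranspose 𝔸) lo' hi' := (Torus.nearIso_majorTranspose_iff 𝔸 lo' hi').2 h𝔸
  rw [real_inner_space_eq_sum, Finset.mul_sum]
  refine Finset.sum_le_sum fun z _ => ?_
  rw [re_inner_dampL_apply 𝔸 γ₁ hu z]
  have hk : ∑ j, (z.1 j : ℂ) * (u z) j = 0 := by rw [← kdot_apply]; exact kdot_eq_zero_of_mem_ladderSub hu z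
  have h := IsWeakTensorPassiveVectorOn.re_inner_symbT_le_abs_hi_mul hT hk
  nlinarith [h, Real.pi_pos]

/-- The damping form is nonnegative on transversal states (`lo' ≥ 0`). [cite: Giaquinta1983MultipleIntegrals, Ch. III §2 eq. (2.2)] -/
theorem real_inner_dampL_nonneg {R : ℕ} {L : Set (Fin 3 → ℤ)} {𝔸 : Torus.Visc4 (Fin 3)} {lo' hi' : ℝ} (h𝔸 : Torus.NearIso 𝔸 lo' hi')
    (hlo' : 0 ≤ lo') (γ₁ : ℝ) {u : Space R} (hu : u ∈ ladderSub R L) : 0 ≤ ⟪dampL 𝔸 γ₁ R u, u⟫_ℝ := by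
  refine le_trans ?_ (real_inner_dampL_ge h𝔸 γ₁ hu)
  have : 0 ≤ ∑ z : box R, freqNormSq z.1 * ‖u z‖ ^ 2 := Finset.sum_nonneg fun z _ => mul_nonneg (freqNormSq_nonneg _) (sq_nonneg _)
  positivity

/-! ## §3 The site index is dominated by `|z|`: hypothesis h1 -/

/-- Euclidean integer division, seen in `ℝ`: `|(q / r : ℤ)| ≤ |q|/r + 1` for `r > 0`. [folklore] -/
theorem abs_cast_ediv_le {q r : ℤ} (hr : 0 < r) : |((q / r : ℤ) : ℝ)| ≤ |(q : ℝ)| / r + 1 := by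
  have hr' : (0 : ℝ) < r := by exact_mod_cast hr
  have h1 : r * (q / r) ≤ q := Int.mul_ediv_self_le (ne_of_gt hr)
  have h2 : q < r * (q / r) + r := by
    have := Int.lt_mul_ediv_self_add hr (x := q)
    linarith
  have h1' : (r : ℝ) * ((q / r : ℤ) : ℝ) ≤ q := by exact_mod_cast h1
  have h2' : (q : ℝ) < (r : ℝ) * ((q / r : ℤ) : ℝ) + r := by exact_mod_cast h2
  rw [abs_le]
  constructor
  · -- lower: −(|q|/r + 1) ≤ q/r: from q < r d + r ⇒ d > q/r − 1 ≥ −|q|/r − 1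
    have hq : -|(q : ℝ)| ≤ q := neg_abs_le _
    have : ((q : ℝ) - r) / r < ((q / r : ℤ) : ℝ) := by rw [div_lt_iff₀ hr']; linarith
    have e : ((q : ℝ) - r) / r = q / r - 1 := by field_simp
    rw [e] at this
    have hq' : -|(q : ℝ)| / r ≤ q / r := div_le_div_of_nonneg_right hq hr'.le
    rw [neg_div] at hq'
    linarith
  · have hq : (q : ℝ) ≤ |(q : ℝ)| := le_abs_self _
    have : ((q / r : ℤ) : ℝ) ≤ (q : ℝ) / r := by rw [le_div_iff₀ hr']; linarith
    have hq' : (q : ℝ) / r ≤ |(q : ℝ)| / r := div_le_div_of_nonneg_right hq hr'.le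
    linarith

set_option maxHeartbeats 400000 in -- pre-budgeted (ops-buildfix rule): heavy arithmetic, above the farm build cliff
/-- **The site index is dominated by `|z|`**: `κ_m(z)² ≤ 7|z|²` for `m ≠ 0`, `z ≠ 0` (`|κ| ≤ |z·m|/|m|² + 3/2 ≤ |z|/|m| + 3/2`).
[cite: BedrossianCotiZelati2017, §2] -/
theorem siteIndex_sq_le {m z : Fin 3 → ℤ} (hm : m ≠ 0) (hz : z ≠ 0) : siteIndex m z ^ 2 ≤ 7 * freqNormSq z := by
  have hr : 0 < zdot m m := by
    have h : (0 : ℝ) < freqNormSq m := freqNormSq_pos_of_ne_zero' hm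
    have e : (zdot m m : ℝ) = freqNormSq m := by rw [cast_zdot, freqNormSq]; exact Finset.sum_congr rfl fun i _ => by ring
    exact_mod_cast (e ▸ h)
  have hr' : (0 : ℝ) < (zdot m m : ℝ) := by exact_mod_cast hr
  have hrm : (zdot m m : ℝ) = freqNormSq m := by rw [cast_zdot, freqNormSq]; exact Finset.sum_congr rfl fun i _ => by ring
  have hq : (zdot z m : ℝ) = ∑ i, (z i : ℝ) * m i := cast_zdot z m
  have hcs : (zdot z m : ℝ) ^ 2 ≤ freqNormSq z * freqNormSq m := by rw [hq]; exact dot_sq_le_freqNormSq_mul z m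
  have h1 := abs_cast_ediv_le (q := zdot z m) hr
  have hz1 : 1 ≤ freqNormSq z := Torus.one_le_freqNormSq_of_ne_zero hz
  have hm1 : 1 ≤ freqNormSq m := Torus.one_le_freqNormSq_of_ne_zero hm
  -- |κ| ≤ |q|/r + 3/2
  have hκ : |siteIndex m z| ≤ |(zdot z m : ℝ)| / (zdot m m : ℝ) + 3 / 2 := by
    rw [siteIndex_def]
    calc |((zdot z m / zdot m m : ℤ) : ℝ) + 1 / 2| ≤ |((zdot z m / zdot m m : ℤ) : ℝ)| + |(1 / 2 : ℝ)| := abs_add_le _ _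
      _ ≤ |(zdot z m : ℝ)| / (zdot m m : ℝ) + 1 + 1 / 2 := by rw [abs_of_pos (by norm_num : (0:ℝ) < 1 / 2)]; linarith
      _ = _ := by ring
  -- (|q|/r)² ≤ |z|²|m|²/|m|⁴ = |z|²/|m|² ≤ |z|²
  have hqr : (|(zdot z m : ℝ)| / (zdot m m : ℝ)) ^ 2 ≤ freqNormSq z := by
    rw [div_pow, sq_abs, hrm, div_le_iff₀ (by positivity)]
    nlinarith
  have hsq : siteIndex m z ^ 2 = |siteIndex m z| ^ 2 := (sq_abs _).symm
  rw [hsq]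
  have hκ0 : 0 ≤ |siteIndex m z| := abs_nonneg _
  have hA0 : 0 ≤ |(zdot z m : ℝ)| / (zdot m m : ℝ) := by positivity
  nlinarith [hκ, hqr, pow_le_pow_left₀ hκ0 hκ 2]

/-- `‖K u‖² ≤ 7·Σ_z |z|²‖u_z‖²` for the site-index operator of a nonzero direction. [cite: BedrossianCotiZelati2017, §2] -/
theorem norm_sq_indexL_le {R : ℕ} {m : Fin 3 → ℤ} (hm : m ≠ 0) (u : Space R) :
    ‖indexL R m u‖ ^ 2 ≤ 7 * ∑ z : box R, freqNormSq z.1 * ‖u z‖ ^ 2 := by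
  rw [PiLp.norm_sq_eq_of_L2, Finset.mul_sum]
  refine Finset.sum_le_sum fun z _ => ?_
  rw [indexL_apply, norm_smul, mul_pow, Complex.norm_real, Real.norm_eq_abs, sq_abs]
  have h := siteIndex_sq_le hm (ne_zero_of_mem_box z.2)
  nlinarith [sq_nonneg ‖u z‖]

/-- **Hypothesis h1 of the hypocoercivity lemma**: `(4π²lo'/7)·‖K u‖² ≤ ⟪dampL u, u⟫_ℝ` for transversal `u`, `NearIso 𝔸 lo' hi'`, `lo' ≥ 0`.
[cite: BedrossianCotiZelati2017, §2] -/
theorem inner_dampL_ge_indexL {R : ℕ} {L : Set (Fin 3 → ℤ)} {𝔸 : Torus.Visc4 (Fin 3)} {lo' hi' : ℝ} (h𝔸 : Torus.NearIso 𝔸 lo' hi')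
    (hlo' : 0 ≤ lo') (γ₁ : ℝ) {m : Fin 3 → ℤ} (hm : m ≠ 0) {u : Space R} (hu : u ∈ ladderSub R L) :
    4 * Real.pi ^ 2 * lo' / 7 * ‖indexL R m u‖ ^ 2 ≤ ⟪dampL 𝔸 γ₁ R u, u⟫_ℝ := by
  have h1 := norm_sq_indexL_le (R := R) hm u
  have h2 := real_inner_dampL_ge h𝔸 γ₁ hu
  have h3 : 4 * Real.pi ^ 2 * lo' / 7 * ‖indexL R m u‖ ^ 2 ≤ 4 * Real.pi ^ 2 * lo' / 7 * (7 * ∑ z : box R, freqNormSq z.1 * ‖u z‖ ^ 2) :=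
    mul_le_mul_of_nonneg_left h1 (by positivity)
  linarith

/-! ## §4 The bond operator on a hopping ladder: hypotheses h3 and h2 -/

/-- `‖hopCoeffᵢ(z)‖ = 2π|êᵢ·z|`. [cite: MeshalkinSinai1961, pp. 1700–1705] -/
theorem norm_hopCoeff (W₁ : LatticeWord k₀) (i : Fin k₀) (z : Fin 3 → ℤ) :
    ‖hopCoeff W₁ i z‖ = 2 * Real.pi * |∑ a, (W₁.phase i).e a * (z a : ℝ)| := by
  have e : (∑ a, ((W₁.phase i).e a : ℂ) * (z a : ℂ)) = ((∑ a, (W₁.phase i).e a * (z a : ℝ) : ℝ) : ℂ) := by push_cast; rfl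
  rw [hopCoeff, norm_neg, e, norm_mul, norm_mul, norm_mul, Complex.norm_I, mul_one, Complex.norm_real, Complex.norm_real,
    Complex.norm_two, Real.norm_of_nonneg Real.pi_pos.le, Real.norm_eq_abs]

/-- Along an `mᵢ`-ladder `êᵢ·z` is constant (`êᵢ ⊥ mᵢ`). [cite: MeshalkinSinai1961, pp. 1700–1705] -/
theorem sum_e_mul_eq_of_mem_ladder (W₁ : LatticeWord k₀) (i : Fin k₀) {z₀ z : Fin 3 → ℤ} (hz : z ∈ ladder z₀ (W₁.phase i).m) :
    ∑ a, (W₁.phase i).e a * (z a : ℝ) = ∑ a, (W₁.phase i).e a * (z₀ a : ℝ) := by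
  obtain ⟨k, rfl⟩ := hz
  have he : ∑ a, (W₁.phase i).e a * ((W₁.phase i).m a : ℝ) = 0 := by
    have hc := sum_e_mul_m_eq_zero W₁ i
    have hcast : ((∑ a, (W₁.phase i).e a * ((W₁.phase i).m a : ℝ) : ℝ) : ℂ) = ∑ a, ((W₁.phase i).e a : ℂ) * ((W₁.phase i).m a : ℂ) := by
      push_cast; rfl
    exact_mod_cast (hcast.trans hc)
  simp only [Pi.add_apply, Pi.smul_apply, smul_eq_mul, Int.cast_add, Int.cast_mul, mul_add, Finset.sum_add_distrib]
  have : ∑ a, (W₁.phase i).e a * ((k : ℝ) * ((W₁.phase i).m a : ℝ)) = (k : ℝ) * ∑ a, (W₁.phase i).e a * ((W₁.phase i).m a : ℝ) := by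
    rw [Finset.mul_sum]; exact Finset.sum_congr rfl fun a _ => by ring
  rw [this, he, mul_zero, add_zero]

/-- **The bond operator, fibrewise bound on a ladder**: for `u ∈ ladderSub R (ladder z₀ mᵢ)`,
`‖(K hopL u − hopL K u)_z‖ ≤ a·(‖u_{z−mᵢ}‖ + ‖u_{z+mᵢ}‖)`, `a = 2π|êᵢ·z₀|‖αᵢ‖`. [cite: BedrossianCotiZelati2017, §2] -/
theorem norm_bond_apply_le (W₁ : LatticeWord k₀) {R : ℕ} (i : Fin k₀) (z₀ : Fin 3 → ℤ) {u : Space R}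
    (hu : u ∈ ladderSub R (ladder z₀ (W₁.phase i).m)) (z : box R) :
    ‖(indexL R (W₁.phase i).m (hopL W₁ R i u) - hopL W₁ R i (indexL R (W₁.phase i).m u)) z‖ ≤
      2 * Real.pi * |∑ a, (W₁.phase i).e a * (z₀ a : ℝ)| * ‖slotAmp W₁ i‖ *
        (‖coordL R (z.1 - (W₁.phase i).m) u‖ + ‖coordL R (z.1 + (W₁.phase i).m) u‖) := by
  have hm0 : zdot (W₁.phase i).m (W₁.phase i).m ≠ 0 := by
    have h : (0 : ℝ) < freqNormSq (W₁.phase i).m := freqNormSq_pos_of_ne_zero' (W₁.phase i).m_ne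
    have e : (zdot (W₁.phase i).m (W₁.phase i).m : ℝ) = freqNormSq (W₁.phase i).m := by
      rw [cast_zdot, freqNormSq]; exact Finset.sum_congr rfl fun j _ => by ring
    have : (zdot (W₁.phase i).m (W₁.phase i).m : ℝ) ≠ 0 := by rw [e]; exact h.ne'
    exact_mod_cast this
  rw [indexL_hopL_sub_apply W₁ R i hm0 u z]
  by_cases hz : z.1 ∈ ladder z₀ (W₁.phase i).m
  · rw [norm_smul, norm_hopCoeff, sum_e_mul_eq_of_mem_ladder W₁ i hz]
    have hP := norm_transversalProj_le z.1 (slotAmp W₁ i • transversalProj (z.1 - (W₁.phase i).m) (coordL R (z.1 - (W₁.phase i).m) u) -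
      starRingEnd ℂ (slotAmp W₁ i) • transversalProj (z.1 + (W₁.phase i).m) (coordL R (z.1 + (W₁.phase i).m) u))
    have hin : ‖slotAmp W₁ i • transversalProj (z.1 - (W₁.phase i).m) (coordL R (z.1 - (W₁.phase i).m) u) -
        starRingEnd ℂ (slotAmp W₁ i) • transversalProj (z.1 + (W₁.phase i).m) (coordL R (z.1 + (W₁.phase i).m) u)‖ ≤
        ‖slotAmp W₁ i‖ * (‖coordL R (z.1 - (W₁.phase i).m) u‖ + ‖coordL R (z.1 + (W₁.phase i).m) u‖) := by
      refine (norm_sub_le _ _).trans ?_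
      rw [norm_smul, norm_smul, RCLike.norm_conj, mul_add]
      gcongr
      · exact norm_transversalProj_le _ _
      · exact norm_transversalProj_le _ _
    have h0 : 0 ≤ 2 * Real.pi * |∑ a, (W₁.phase i).e a * (z₀ a : ℝ)| := by positivity
    calc 2 * Real.pi * |∑ a, (W₁.phase i).e a * (z₀ a : ℝ)| * ‖transversalProj z.1 _‖
        ≤ 2 * Real.pi * |∑ a, (W₁.phase i).e a * (z₀ a : ℝ)| * (‖slotAmp W₁ i‖ *
            (‖coordL R (z.1 - (W₁.phase i).m) u‖ + ‖coordL R (z.1 + (W₁.phase i).m) u‖)) :=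
          mul_le_mul_of_nonneg_left (hP.trans hin) h0
      _ = _ := by ring
  · -- off the ladder both neighbours vanish
    have h1 : z.1 - (W₁.phase i).m ∉ ladder z₀ (W₁.phase i).m := fun h => hz (sub_mem_ladder_iff.1 h)
    have h2 : z.1 + (W₁.phase i).m ∉ ladder z₀ (W₁.phase i).m := fun h => hz (add_mem_ladder_iff.1 h)
    rw [coordL_eq_zero_of_mem_ladderSub hu h1, coordL_eq_zero_of_mem_ladderSub hu h2]
    simp

set_option maxHeartbeats 400000 in -- pre-budgeted (ops-buildfix rule): heavy arithmetic, above the farm build cliff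
/-- **Hypothesis h3**: `‖K hopL u − hopL K u‖² ≤ 4a²‖u‖²` on the ladder subspace, `a = 2π|êᵢ·z₀|‖αᵢ‖`. [cite: BedrossianCotiZelati2017, §2] -/
theorem norm_sq_bond_le (W₁ : LatticeWord k₀) {R : ℕ} (i : Fin k₀) (z₀ : Fin 3 → ℤ) {u : Space R}
    (hu : u ∈ ladderSub R (ladder z₀ (W₁.phase i).m)) :
    ‖indexL R (W₁.phase i).m (hopL W₁ R i u) - hopL W₁ R i (indexL R (W₁.phase i).m u)‖ ^ 2 ≤
      4 * (2 * Real.pi * |∑ a, (W₁.phase i).e a * (z₀ a : ℝ)| * ‖slotAmp W₁ i‖) ^ 2 * ‖u‖ ^ 2 := by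
  set a : ℝ := 2 * Real.pi * |∑ a, (W₁.phase i).e a * (z₀ a : ℝ)| * ‖slotAmp W₁ i‖ with ha
  have ha0 : 0 ≤ a := by positivity
  rw [PiLp.norm_sq_eq_of_L2]
  have hz : ∀ z : box R, ‖(indexL R (W₁.phase i).m (hopL W₁ R i u) - hopL W₁ R i (indexL R (W₁.phase i).m u)) z‖ ^ 2 ≤
      2 * a ^ 2 * (‖coordL R (z.1 - (W₁.phase i).m) u‖ ^ 2 + ‖coordL R (z.1 + (W₁.phase i).m) u‖ ^ 2) := by
    intro z
    have h := norm_bond_apply_le W₁ i z₀ hu z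
    rw [← ha] at h
    have h' := pow_le_pow_left₀ (norm_nonneg _) h 2
    refine h'.trans ?_
    nlinarith [sq_nonneg (‖coordL R (z.1 - (W₁.phase i).m) u‖ - ‖coordL R (z.1 + (W₁.phase i).m) u‖), sq_nonneg a]
  refine (Finset.sum_le_sum fun z _ => hz z).trans ?_
  rw [← Finset.mul_sum, Finset.sum_add_distrib]
  have h1 := sum_norm_sq_coordL_sub_le (W₁.phase i).m u
  have h2 := sum_norm_sq_coordL_add_le (W₁.phase i).m u
  rw [PiLp.norm_sq_eq_of_L2] at h1 h2 ⊢
  nlinarith [sq_nonneg a]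

set_option maxHeartbeats 400000 in -- pre-budgeted (ops-buildfix rule): heavy arithmetic, above the farm build cliff
/-- Per-site weighted bound for the bond operator on a ladder:
`|z|²‖(Cu)_z‖² ≤ 4a²(1+|mᵢ|²)·(|z−mᵢ|²‖u_{z−mᵢ}‖² + |z+mᵢ|²‖u_{z+mᵢ}‖²)`. [cite: BedrossianCotiZelati2017, §2] -/
theorem freqNormSq_mul_norm_sq_bond_apply_le (W₁ : LatticeWord k₀) {R : ℕ} (i : Fin k₀) (z₀ : Fin 3 → ℤ) {u : Space R}
    (hu : u ∈ ladderSub R (ladder z₀ (W₁.phase i).m)) (z : box R) :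
    freqNormSq z.1 * ‖(indexL R (W₁.phase i).m (hopL W₁ R i u) - hopL W₁ R i (indexL R (W₁.phase i).m u)) z‖ ^ 2 ≤
      4 * (2 * Real.pi * |∑ a, (W₁.phase i).e a * (z₀ a : ℝ)| * ‖slotAmp W₁ i‖) ^ 2 * (1 + freqNormSq (W₁.phase i).m) *
        (freqNormSq (z.1 - (W₁.phase i).m) * ‖coordL R (z.1 - (W₁.phase i).m) u‖ ^ 2 +
          freqNormSq (z.1 + (W₁.phase i).m) * ‖coordL R (z.1 + (W₁.phase i).m) u‖ ^ 2) := by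
  have h := norm_bond_apply_le W₁ i z₀ hu z
  have hF := freqNormSq_nonneg z.1
  have hM := freqNormSq_nonneg (W₁.phase i).m
  have ha0 : 0 ≤ 2 * Real.pi * |∑ a, (W₁.phase i).e a * (z₀ a : ℝ)| * ‖slotAmp W₁ i‖ := by positivity
  have hn1 := norm_nonneg (coordL R (z.1 - (W₁.phase i).m) u)
  have hn2 := norm_nonneg (coordL R (z.1 + (W₁.phase i).m) u)
  -- ‖C_z‖² ≤ 2a²(n₋² + n₊²)
  have hC2 : ‖(indexL R (W₁.phase i).m (hopL W₁ R i u) - hopL W₁ R i (indexL R (W₁.phase i).m u)) z‖ ^ 2 ≤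
      2 * (2 * Real.pi * |∑ a, (W₁.phase i).e a * (z₀ a : ℝ)| * ‖slotAmp W₁ i‖) ^ 2 *
        (‖coordL R (z.1 - (W₁.phase i).m) u‖ ^ 2 + ‖coordL R (z.1 + (W₁.phase i).m) u‖ ^ 2) := by
    have h' := pow_le_pow_left₀ (norm_nonneg _) h 2
    refine h'.trans ?_
    rw [mul_pow]
    have hsum : (‖coordL R (z.1 - (W₁.phase i).m) u‖ + ‖coordL R (z.1 + (W₁.phase i).m) u‖) ^ 2 ≤
        2 * (‖coordL R (z.1 - (W₁.phase i).m) u‖ ^ 2 + ‖coordL R (z.1 + (W₁.phase i).m) u‖ ^ 2) := by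
      nlinarith [sq_nonneg (‖coordL R (z.1 - (W₁.phase i).m) u‖ - ‖coordL R (z.1 + (W₁.phase i).m) u‖)]
    have := mul_le_mul_of_nonneg_left hsum (sq_nonneg (2 * Real.pi * |∑ a, (W₁.phase i).e a * (z₀ a : ℝ)| * ‖slotAmp W₁ i‖))
    linarith
  -- |z|² n∓² ≤ 2(1+|m|²)|z∓m|² n∓²
  have hw : ∀ w : Fin 3 → ℤ, freqNormSq z.1 ≤ 2 * freqNormSq w + 2 * freqNormSq (W₁.phase i).m →
      freqNormSq z.1 * ‖coordL R w u‖ ^ 2 ≤ 2 * (1 + freqNormSq (W₁.phase i).m) * (freqNormSq w * ‖coordL R w u‖ ^ 2) := by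
    intro w hzw
    by_cases hb : w ∈ box R
    · have h1 : 1 ≤ freqNormSq w := Torus.one_le_freqNormSq_of_ne_zero (ne_zero_of_mem_box hb)
      have hle : freqNormSq z.1 ≤ 2 * (1 + freqNormSq (W₁.phase i).m) * freqNormSq w := by nlinarith
      have := mul_le_mul_of_nonneg_right hle (sq_nonneg ‖coordL R w u‖)
      linarith
    · rw [coordL_apply_of_not_mem hb, norm_zero]; simp
  have hw1 := hw (z.1 - (W₁.phase i).m) (LadderCrush.freqNormSq_le_two_mul_sub z.1 (W₁.phase i).m)
  have hw2 := hw (z.1 + (W₁.phase i).m) (LadderCrush.freqNormSq_le_two_mul_add z.1 (W₁.phase i).m)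
  have step1 := mul_le_mul_of_nonneg_left hC2 hF
  have ha2 : 0 ≤ 2 * (2 * Real.pi * |∑ a, (W₁.phase i).e a * (z₀ a : ℝ)| * ‖slotAmp W₁ i‖) ^ 2 := by positivity
  calc freqNormSq z.1 * ‖(indexL R (W₁.phase i).m (hopL W₁ R i u) - hopL W₁ R i (indexL R (W₁.phase i).m u)) z‖ ^ 2
      ≤ 2 * (2 * Real.pi * |∑ a, (W₁.phase i).e a * (z₀ a : ℝ)| * ‖slotAmp W₁ i‖) ^ 2 *
          (freqNormSq z.1 * ‖coordL R (z.1 - (W₁.phase i).m) u‖ ^ 2 + freqNormSq z.1 * ‖coordL R (z.1 + (W₁.phase i).m) u‖ ^ 2) := by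
        linarith
    _ ≤ 2 * (2 * Real.pi * |∑ a, (W₁.phase i).e a * (z₀ a : ℝ)| * ‖slotAmp W₁ i‖) ^ 2 *
          (2 * (1 + freqNormSq (W₁.phase i).m) * (freqNormSq (z.1 - (W₁.phase i).m) * ‖coordL R (z.1 - (W₁.phase i).m) u‖ ^ 2) +
            2 * (1 + freqNormSq (W₁.phase i).m) * (freqNormSq (z.1 + (W₁.phase i).m) * ‖coordL R (z.1 + (W₁.phase i).m) u‖ ^ 2)) :=
        mul_le_mul_of_nonneg_left (add_le_add hw1 hw2) ha2
    _ = _ := by ring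

set_option maxHeartbeats 400000 in -- pre-budgeted (ops-buildfix rule): heavy arithmetic, above the farm build cliff
/-- **Hypothesis h2**: `⟪dampL(Cu), Cu⟫ ≤ (8a²(1+|mᵢ|²)·|hi'|/lo')·⟪dampL u, u⟫` for `u ∈ ladderSub R (ladder z₀ mᵢ)`, `C = K hopL − hopL K`,
`NearIso 𝔸 lo' hi'`, `lo' > 0`. [cite: BedrossianCotiZelati2017, §2] -/
theorem inner_dampL_bond_le (W₁ : LatticeWord k₀) {R : ℕ} (i : Fin k₀) (z₀ : Fin 3 → ℤ) {𝔸 : Torus.Visc4 (Fin 3)} {lo' hi' : ℝ}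
    (h𝔸 : Torus.NearIso 𝔸 lo' hi') (hlo' : 0 < lo') (γ₁ : ℝ) {u : Space R} (hu : u ∈ ladderSub R (ladder z₀ (W₁.phase i).m)) :
    ⟪dampL 𝔸 γ₁ R (indexL R (W₁.phase i).m (hopL W₁ R i u) - hopL W₁ R i (indexL R (W₁.phase i).m u)),
        indexL R (W₁.phase i).m (hopL W₁ R i u) - hopL W₁ R i (indexL R (W₁.phase i).m u)⟫_ℝ ≤
      8 * (2 * Real.pi * |∑ a, (W₁.phase i).e a * (z₀ a : ℝ)| * ‖slotAmp W₁ i‖) ^ 2 * (1 + freqNormSq (W₁.phase i).m) * |hi'| / lo' *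
        ⟪dampL 𝔸 γ₁ R u, u⟫_ℝ := by
  have hCV := bond_mem_ladderSub_ladder W₁ i z₀ hu
  have hup := real_inner_dampL_le h𝔸 γ₁ hCV
  have hlow := real_inner_dampL_ge h𝔸 γ₁ hu
  have hM := freqNormSq_nonneg (W₁.phase i).m
  have ha2 : 0 ≤ 4 * (2 * Real.pi * |∑ a, (W₁.phase i).e a * (z₀ a : ℝ)| * ‖slotAmp W₁ i‖) ^ 2 * (1 + freqNormSq (W₁.phase i).m) := by
    positivity
  -- Σ |z|²‖C_z‖² ≤ 8 a² (1+|m|²) Σ |w|²‖u_w‖²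
  have hsum : ∑ z : box R, freqNormSq z.1 * ‖(indexL R (W₁.phase i).m (hopL W₁ R i u) - hopL W₁ R i (indexL R (W₁.phase i).m u)) z‖ ^ 2
      ≤ 8 * (2 * Real.pi * |∑ a, (W₁.phase i).e a * (z₀ a : ℝ)| * ‖slotAmp W₁ i‖) ^ 2 * (1 + freqNormSq (W₁.phase i).m) *
          ∑ w : box R, freqNormSq w.1 * ‖u w‖ ^ 2 := by
    refine (Finset.sum_le_sum fun z _ => freqNormSq_mul_norm_sq_bond_apply_le W₁ i z₀ hu z).trans ?_
    rw [← Finset.mul_sum, Finset.sum_add_distrib]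
    have h1 := sum_weight_norm_sq_coordL_sub_le (R := R) (fun w => freqNormSq w) (fun w => freqNormSq_nonneg w) (W₁.phase i).m u
    have h2 := sum_weight_norm_sq_coordL_add_le (R := R) (fun w => freqNormSq w) (fun w => freqNormSq_nonneg w) (W₁.phase i).m u
    have := mul_le_mul_of_nonneg_left (add_le_add h1 h2) ha2
    linarith
  have hS : 0 ≤ ∑ w : box R, freqNormSq w.1 * ‖u w‖ ^ 2 := Finset.sum_nonneg fun w _ => mul_nonneg (freqNormSq_nonneg _) (sq_nonneg _)
  have hhi : 0 ≤ 4 * Real.pi ^ 2 * |hi'| := by positivity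
  have step1 := mul_le_mul_of_nonneg_left hsum hhi
  have hcoef : 0 ≤ 8 * (2 * Real.pi * |∑ a, (W₁.phase i).e a * (z₀ a : ℝ)| * ‖slotAmp W₁ i‖) ^ 2 * (1 + freqNormSq (W₁.phase i).m) * |hi'| / lo' := by
    positivity
  have step2 := mul_le_mul_of_nonneg_left hlow hcoef
  have e : ∀ A M S P H lo : ℝ, lo ≠ 0 → 8 * A * M * H / lo * (P * lo * S) = P * H * (8 * A * M * S) := by
    intro A M S P H lo hlo; field_simp
  have e' := e ((2 * Real.pi * |∑ a, (W₁.phase i).e a * (z₀ a : ℝ)| * ‖slotAmp W₁ i‖) ^ 2) (1 + freqNormSq (W₁.phase i).m)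
    (∑ w : box R, freqNormSq w.1 * ‖u w‖ ^ 2) (4 * Real.pi ^ 2) |hi'| lo' hlo'.ne'
  linarith [hup, step1, step2, e']

end Summit.AnomalousDissipation.AnomalousDissipation.Theorems.SolenoidalFractalHomogenisation.LagrangianStep.Sideband

end
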